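/-
Copyright (c) 2026 the pub-hodgecm-mathlib formalisation cell (harness21).  Prover seat hodgecm-mathlib-K2E1-p16 (g2), Track B «K2-LIT» ENGINE E1, h413 = `stmt-HodgeConjecture-24833`,
route `HCCMUnconditional`, R90-S8 «ContSpec-n½» #2∕#3 chain, deal S8-R152 (a) (S8 dealer R90-CS-plan (g3)): (L2) PAYER PART 1 — the `K`-pairings of a finitely-coordinatised family
(`φ̃_z = Σ_j q_j(z)·b_j`, ★ scattering coordinates p862021∕p862274) are finite sums of the coordinates, hence holomorphic wherever the coordinates are.
-/
import Summits.HodgeConjecture.HodgeConjecture.Theorems.K2E1MaassSelbergContinuedCMTwo    -- ★ (K2E4-p14) `differentiableOn_conj_comp_conj` (Schwarz reflection of a holomorphic scalar)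
import HarnessLib

/-!
# h413 ∕ R90-S8 (L2) part 1 — `K2E1ChiScatteringPairingsTubeCMThree`: `K`-PAIRINGS OF A FINITELY-COORDINATISED HOLOMORPHIC FAMILY ARE HOLOMORPHIC (the tube side of the continued
# scalars `wc, Bc` of ★ p863403)

Cell `pub/hodgecm-mathlib`, crux H413 = `stmt-HodgeConjecture-24833`; S8 dealer R90-CS-plan (g3) S8-R152 (a).  THEOREMS ONLY (no `def`, no `instance`, no notation, no named-fact
hypothesis, no `sorry`); lane `--supports stmt-HodgeConjecture-24833 --as helper` (count-neutral).  PURE finite-dimensional bookkeeping over a measure space `(X, μ)` (consumer: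
`X = K_U`, `μ = μ_K`) — no automorphic object is named; the consumer instantiates `Φ z := φ̃_z` (the intertwined coefficient of the χ-pair section) and takes the coordinate identity
`hq : Σ_j q_j(z)·b_j = Φ z` on the tube `S = {2 < Re}` from ★ p862274 `exists_scatteringCoords_of_basis_cm_three` (with `ν 𝓕 = 1`, so its factor `(ν𝓕)⁻¹` is `1`) ∕ ★ p862021.

THE MATHEMATICS ([BernsteinLapid2019, §4 p. 10]; [MoeglinWaldspurger1995, II.1.7, IV.2.3]).  The literal scalars of ★ (ii) `chiTube_threeScalars_of_family` are `K`-pairings of the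
intertwined coefficient: `w(z) = [η]·∫_K φ̃_z·conj φ dμ_K`, `B(z, z′) = κ·∫_K φ̃_z·conj φ̃_{z′} dμ_K`.  On the tube, `φ̃_z = Σ_j q_j(z) b_j` with `q_j` HOLOMORPHIC and `b_j` a fixed finite
family (a basis of the finite-dimensional pair-section space `V(χ₁ʷ, χ₂; K′, ω)`), so
`∫ φ̃_z conj ψ = Σ_j q_j(z)·⟨b_j, ψ⟩` (§2) and `∫ φ̃_z conj φ̃_{z′} = Σ_{j,l} q_j(z)·conj q_l(z′)·⟨b_j, b_l⟩` (§4): the first is holomorphic in `z` (§3), the second holomorphic in `z` and, in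
the variable `u = conj z′`, holomorphic in `u` (★ `differentiableOn_conj_comp_conj`) (§5) — exactly the shapes `hw`, `hB₁`, `hB₂` of ★ p862892 ∕ (L2) of ★ p863403 ON THE TUBE.  The
CONTINUATION beyond the tube (to the quarter-plane domains reaching `3∕2`) is part 2: the same finite sums with the CONTINUED coordinates (X-system ∕ [BernsteinLapid2019]), agreement on
the tube being these identities.
* §1 `apply_eq_sum_of_coords` (pointwise form of `hq`).  §2 **`pairing_eq_sum_coords`**.  §3 **`differentiableOn_pairing_of_coords`**.
* §4 **`kernel_eq_sum_coords`**.  §5 **`differentiableOn_kernel_fst_of_coords`**, **`differentiableOn_kernel_snd_conj_of_coords`**.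
HONEST LABEL: HC_CM is proved only modulo the 7 printed citations (2 remaining named inputs: hLiu418 = `stmt-HodgeConjecture-24832`, h413 = `stmt-HodgeConjecture-24833`) until rung 0
closes; this file asserts no named fact and closes no socket; count-neutral; visible letters: the coordinate identity `hq`, holomorphy `hqd` of the coordinates, integrability of the
finitely many pairings `b_j·conj ψ`, `b_j·conj b_l`.

## References
* [BernsteinLapid2019] J. Bernstein, E. Lapid, *On the meromorphic continuation of Eisenstein series*, J. AMS 37 (2024), §4 p. 10.
* [MoeglinWaldspurger1995] C. Mœglin, J.-L. Waldspurger, *Spectral decomposition and Eisenstein series* (1995), II.1.7, IV.2.3.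
-/

set_option autoImplicit false
-- the mandated namespace repeats `HodgeConjecture.HodgeConjecture`, as in every `Theorems/*.lean` of this sub-problem
set_option linter.dupNamespace false

noncomputable section

open MeasureTheory Measure Set
open scoped ComplexConjugate
open Summit.HodgeConjecture.HodgeConjecture.Cruxes.H413.K2E1MaassSelbergContinuedCMTwo (differentiableOn_conj_comp_conj)

namespace Summit.HodgeConjecture.HodgeConjecture.Cruxes.H413.K2E1ChiScatteringPairingsTubeCMThree

variable {X : Type*} [MeasurableSpace X] (μ : Measure X)
variable {ι : Type} [Fintype ι] {b : ι → X → ℂ} {q : ι → ℂ → ℂ} {Φ : ℂ → X → ℂ} {S : Set ℂ}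

/-! ## §1 The coordinate identity, pointwise -/

omit [MeasurableSpace X] in
/-- `Φ z x = Σ_j q_j(z)·b_j(x)` on `S` — the coordinate identity `Σ_j q_j(z) • b_j = Φ z` read at a point. [cite: BernsteinLapid2019, §4 p. 10] -/
theorem apply_eq_sum_of_coords (hq : ∀ z ∈ S, (∑ j, q j z • b j) = Φ z) {z : ℂ} (hz : z ∈ S) (x : X) : Φ z x = ∑ j, q j z * b j x := by
  rw [← hq z hz, Finset.sum_apply]
  simp only [Pi.smul_apply, smul_eq_mul]

/-! ## §2 The pairing against a fixed function is a finite sum of coordinates -/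

/-- **`∫ Φ_z·conj ψ dμ = Σ_j q_j(z)·∫ b_j·conj ψ dμ`** on `S`, for integrable pairings `b_j·conj ψ`. [cite: MoeglinWaldspurger1995, IV.2.3] [cite: BernsteinLapid2019, §4 p. 10] -/
theorem pairing_eq_sum_coords (hq : ∀ z ∈ S, (∑ j, q j z • b j) = Φ z) {ψ : X → ℂ} (hint : ∀ j, Integrable (fun x => b j x * conj (ψ x)) μ) {z : ℂ} (hz : z ∈ S) :
    ∫ x, Φ z x * conj (ψ x) ∂μ = ∑ j, q j z * ∫ x, b j x * conj (ψ x) ∂μ := by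
  have h1 : (fun x => Φ z x * conj (ψ x)) = fun x => ∑ j, q j z * (b j x * conj (ψ x)) := by
    funext x
    rw [apply_eq_sum_of_coords hq hz x, Finset.sum_mul]
    refine Finset.sum_congr rfl fun j _ => ?_
    ring
  rw [h1, integral_finsetSum _ fun j _ => (hint j).const_mul _]
  refine Finset.sum_congr rfl fun j _ => ?_
  exact integral_const_mul _ _

/-! ## §3 Holomorphy of the pairing on `S` -/

/-- **`z ↦ ∫ Φ_z·conj ψ dμ` IS HOLOMORPHIC ON `S`** when the coordinates are: a finite sum of holomorphic functions times constants (§2). [cite: BernsteinLapid2019, §4 p. 10] -/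
theorem differentiableOn_pairing_of_coords (hq : ∀ z ∈ S, (∑ j, q j z • b j) = Φ z) (hqd : ∀ j, DifferentiableOn ℂ (q j) S)
    {ψ : X → ℂ} (hint : ∀ j, Integrable (fun x => b j x * conj (ψ x)) μ) :
    DifferentiableOn ℂ (fun z : ℂ => ∫ x, Φ z x * conj (ψ x) ∂μ) S := by
  have hsum : DifferentiableOn ℂ (fun z : ℂ => ∑ j, q j z * ∫ x, b j x * conj (ψ x) ∂μ) S :=
    DifferentiableOn.fun_sum fun j _ => (hqd j).mul_const _
  exact hsum.congr fun z hz => pairing_eq_sum_coords μ hq hint hz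

/-! ## §4 The kernel `∫ Φ_z·conj Φ_{z′}` is a finite double sum -/

/-- **`∫ Φ_z·conj Φ_{z′} dμ = Σ_j Σ_l q_j(z)·conj q_l(z′)·∫ b_j·conj b_l dμ`** for `z, z′ ∈ S`, given integrable Gram pairings `b_j·conj b_l`.
[cite: MoeglinWaldspurger1995, IV.2.3] [cite: BernsteinLapid2019, §4 p. 10] -/
theorem kernel_eq_sum_coords (hq : ∀ z ∈ S, (∑ j, q j z • b j) = Φ z) (hbb : ∀ j l, Integrable (fun x => b j x * conj (b l x)) μ)
    {z z' : ℂ} (hz : z ∈ S) (hz' : z' ∈ S) :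
    ∫ x, Φ z x * conj (Φ z' x) ∂μ = ∑ j, ∑ l, q j z * conj (q l z') * ∫ x, b j x * conj (b l x) ∂μ := by
  -- the pairings `b_j · conj Φ_{z′}` are integrable: finite sums of the Gram pairings
  have hconj : ∀ x, conj (Φ z' x) = ∑ l, conj (q l z') * conj (b l x) := fun x => by
    rw [apply_eq_sum_of_coords hq hz' x, _root_.map_sum]
    refine Finset.sum_congr rfl fun l _ => ?_
    rw [map_mul]
  have hint : ∀ j, Integrable (fun x => b j x * conj (Φ z' x)) μ := fun j => by
    have h2 : (fun x => b j x * conj (Φ z' x)) = fun x => ∑ l, conj (q l z') * (b j x * conj (b l x)) := by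
      funext x
      rw [hconj x, Finset.mul_sum]
      refine Finset.sum_congr rfl fun l _ => ?_
      ring
    rw [h2]
    exact integrable_finsetSum _ fun l _ => (hbb j l).const_mul _
  rw [pairing_eq_sum_coords μ hq hint hz]
  refine Finset.sum_congr rfl fun j _ => ?_
  have h3 : (fun x => b j x * conj (Φ z' x)) = fun x => ∑ l, conj (q l z') * (b j x * conj (b l x)) := by
    funext x
    rw [hconj x, Finset.mul_sum]
    refine Finset.sum_congr rfl fun l _ => ?_
    ring
  rw [h3, integral_finsetSum _ fun l _ => (hbb j l).const_mul _, Finset.mul_sum]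
  refine Finset.sum_congr rfl fun l _ => ?_
  rw [integral_const_mul]
  ring

/-! ## §5 Separate holomorphy of the kernel on `S × conj⁻¹ S` -/

/-- **`z ↦ ∫ Φ_z·conj Φ_{z′}` IS HOLOMORPHIC ON `S`** for each `z′ ∈ S` (§4: a finite sum of `q_j` times constants). [cite: BernsteinLapid2019, §4 p. 10] -/
theorem differentiableOn_kernel_fst_of_coords (hq : ∀ z ∈ S, (∑ j, q j z • b j) = Φ z) (hqd : ∀ j, DifferentiableOn ℂ (q j) S)
    (hbb : ∀ j l, Integrable (fun x => b j x * conj (b l x)) μ) {z' : ℂ} (hz' : z' ∈ S) :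
    DifferentiableOn ℂ (fun z : ℂ => ∫ x, Φ z x * conj (Φ z' x) ∂μ) S := by
  have hsum : DifferentiableOn ℂ (fun z : ℂ => ∑ j, ∑ l, q j z * conj (q l z') * ∫ x, b j x * conj (b l x) ∂μ) S :=
    DifferentiableOn.fun_sum fun j _ => DifferentiableOn.fun_sum fun l _ => ((hqd j).mul_const _).mul_const _
  exact hsum.congr fun z hz => kernel_eq_sum_coords μ hq hbb hz hz'

/-- **`u ↦ ∫ Φ_z·conj Φ_{conj u}` IS HOLOMORPHIC ON `conj⁻¹ S`** for each `z ∈ S` (`S` open): in §4's double sum the factor `conj (q_l (conj u))` is holomorphic by Schwarz reflection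
(★ `differentiableOn_conj_comp_conj`).  This is the `hB₂` shape of ★ p862892 on the tube. [cite: BernsteinLapid2019, §4 p. 10] -/
theorem differentiableOn_kernel_snd_conj_of_coords (hS : IsOpen S) (hq : ∀ z ∈ S, (∑ j, q j z • b j) = Φ z) (hqd : ∀ j, DifferentiableOn ℂ (q j) S)
    (hbb : ∀ j l, Integrable (fun x => b j x * conj (b l x)) μ) {z : ℂ} (hz : z ∈ S) :
    DifferentiableOn ℂ (fun u : ℂ => ∫ x, Φ z x * conj (Φ (conj u) x) ∂μ) {u : ℂ | conj u ∈ S} := by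
  have hsum : DifferentiableOn ℂ (fun u : ℂ => ∑ j, ∑ l, q j z * conj (q l (conj u)) * ∫ x, b j x * conj (b l x) ∂μ) {u : ℂ | conj u ∈ S} :=
    DifferentiableOn.fun_sum fun j _ => DifferentiableOn.fun_sum fun l _ => (((differentiableOn_conj_comp_conj hS (hqd l)).const_mul _).mul_const _)
  exact hsum.congr fun u hu => kernel_eq_sum_coords μ hq hbb hz hu

end Summit.HodgeConjecture.HodgeConjecture.Cruxes.H413.K2E1ChiScatteringPairingsTubeCMThree

end
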